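import Literature.NumberTheory.Sieve.BombieriFriedlanderIwaniecLemma1Completion
import Literature.NumberTheory.LFunctions.KloostermanWeilPrimeProofs
import Literature.NumberTheory.LFunctions.GcdSumBounds
import HarnessLib

/-!
# BFI's multiple sums of Kloosterman fractions: the unconditional bound from Weil's estimate

Topic `Literature/NumberTheory/Sieve`.  Everything here is PROVED; no named fact is introduced.

The tree reduces Bombieri–Friedlander–Iwaniec's Theorems 1, 2, 5, 5*, 10 (Acta Math. 156 (1986))
to Deshouillers–Iwaniec's Theorem 12 in its corrected form (BFI, arXiv:1903.01371 (2019), Lemma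
2.1), i.e. to a bound for the sums
`𝓚(C,D,N,R,S) = ∑_{r∼R} ∑_{s∼S} ∑_{0<n≤N} B_{nrs} ∑∑_{(rd,sc)=1} g(c,d) e(n (rd)‾/(sc))`
(`BFI.dispK`), and `…Lemma1Completion` reduces that bound, for the weight `g₀ = w ⊗ w`, to a bound
for the off-diagonal part `𝓚♯(H₀) = BFI.L1.Koff C D N R S H₀ B` — the complete Kloosterman sums
`S(±h, n r̄; sc)`, `1 ≤ h ≤ H₀`, produced by Poisson summation in `d`, weighted by the Fourier
coefficients `Φ_{sc}(±h)` of `w(·/D)`: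
`𝓚♯ = ∑_{r,s,n} B_{nrs} ∑_{c,(r,sc)=1} w(c/C)(sc)⁻¹ ∑_{1≤h≤H₀} (Φ_{sc}(h) S(h, n r̄; sc) + Φ_{sc}(−h) S(−h, n r̄; sc))`.
The bound Deshouillers–Iwaniec prove for `𝓚♯` (`≪ (CDNRS)^ε {CS(RS+N)(C+DR) + C²DS√((RS+N)R)}^{1/2} ‖B‖`)
needs Kuznetsov's formula and the spectral large sieve, absent from Mathlib and the tree.

This file records what the ELEMENTARY theory gives for the same quantities, unconditionally, from
Weil's bound `|S(a, b; q)| ≤ τ(q) (a, b, q)^{1/2} q^{1/2}` (PROVED in the tree: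
`Literature.NumberTheory.LFunctions.weil_kloosterman_bound_holds`):

* `BFI.L1.norm_kl_le_weil` — `|S(h, n r̄; k)| ≤ τ(k) k^{1/2} (h, k)^{1/2}` for `(r, k) = 1`;
* `BFI.L1.norm_offdiag_term_le`, `BFI.L1.norm_Koff_le_weil_sum`, `BFI.L1.norm_Koff_le_weil` —
  termwise, then `‖𝓚♯(H₀)‖ ≤ K_η (CDNRS)^η · D H₀ (CRN)^{1/2} ‖B‖` for every `H₀`;
* `BFI.L1.norm_dispK_le_weil` — hence, with the zero frequency and the tails of
  `…Lemma1Completion` (`H₀ = ⌈2(CDNRS)^{ε/2} SC/D⌉`), **the unconditional bound**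
  `‖𝓚(C, D, N, R, S)‖ ≤ K_ε (CDNRS)^ε C^{1/2} (CS + D) (RN)^{1/2} ‖B‖`
  (`C, D, N ≥ 1`, `R, S ≥ 1/2`, weight `w ⊗ w`).

For comparison (why the spectral theory is needed downstream): against the trivial bound
`≍ CD(RSN)^{1/2}‖B‖` this saves `(CS)^{1/2}/D + (CS)^{-1/2}`, while Deshouillers–Iwaniec's `𝓘‖B‖`,
`𝓘² = CS(RS+N)(C+DR) + C²DS√((RS+N)R) + D²NR`, saves a further power of `CDNRS` in the ranges of
BFI's Lemma 6 (e.g. at `C = D = N = R = X`, `S = 1`: trivial `≍ X³`, this file `≍ X^{5/2}`,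
Deshouillers–Iwaniec `≍ X²`); in BFI's Theorem 1 that is the difference between the levels `x^{1/2}`
and `x^{4/7}`.

## References

* E. Bombieri, J. B. Friedlander, H. Iwaniec, Acta Math. 156 (1986), 203–251, §2 Lemma 1 p. 210.
  [BombieriFriedlanderIwaniecActa1986]
* E. Bombieri, J. B. Friedlander, H. Iwaniec, *Some corrections to an old paper*, arXiv:1903.01371
  (2019), §2 Lemma 2.1. [BombieriFriedlanderIwaniec2019]
* H. Iwaniec, *Spectral methods of automorphic forms*, 2nd ed. (2002), §2.5 (2.25) (Weil's bound).
  [Iwaniec2002]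
-/

noncomputable section

open Finset Real
open scoped ArithmeticFunction.sigma ContDiff FourierTransform ComplexConjugate

namespace Literature.NumberTheory.Sieve

namespace BFI

namespace L1

/-! ### Weil's bound for the complete sums `𝓢_k(h; n, r) = S(h, n r̄; k)` -/

/-- **Weil's bound for `𝓢_k(h; n, r)`**: for `k ≥ 1`, `(r, k) = 1` and all integers `n, h`,
`|𝓢_k(h; n, r)| = |S(h, n r̄; k)| ≤ τ(k) k^{1/2} (h, k)^{1/2}` (the tree's proved
`weil_kloosterman_bound_holds`, and `(h, n r̄, k) ∣ (h, k)`). [cite: Iwaniec2002, §2.5 (2.25)] -/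
theorem norm_kl_le_weil {k : ℕ} [NeZero k] {r : ℕ} (hr : r.Coprime k) (n h : ℤ) :
    ‖kl k r n h‖ ≤ (#k.divisors : ℝ) * Real.sqrt k * Real.sqrt (Int.gcd h k) := by
  rw [kl_eq_kloostermanSum hr]
  have hk0 : 0 < k := Nat.pos_of_ne_zero (NeZero.ne k)
  -- an integer representative of `n r̄`
  set m : ℤ := ((((n : ZMod k) * ((r : ZMod k))⁻¹).val : ℕ) : ℤ) with hm
  have hmc : ((m : ℤ) : ZMod k) = (n : ZMod k) * ((r : ZMod k))⁻¹ := by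
    rw [hm, Int.cast_natCast, ZMod.natCast_zmod_val]
  have hW := LFunctions.weil_kloosterman_bound_holds k h m
  rw [hmc] at hW
  refine hW.trans ?_
  have hgcd : (Nat.gcd (Nat.gcd h.natAbs m.natAbs) k : ℝ) ≤ (Int.gcd h k : ℝ) := by
    have h1 : Nat.gcd (Nat.gcd h.natAbs m.natAbs) k ∣ Nat.gcd h.natAbs k :=
      Nat.gcd_dvd_gcd_of_dvd_left k (Nat.gcd_dvd_left _ _)
    have hI : Int.gcd h k = Nat.gcd h.natAbs k := by rw [Int.gcd_eq_natAbs, Int.natAbs_natCast]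
    rw [hI]
    have hpos : 0 < Nat.gcd h.natAbs k := Nat.gcd_pos_of_pos_right _ hk0
    exact_mod_cast Nat.le_of_dvd hpos h1
  calc Real.sqrt (Nat.gcd (Nat.gcd h.natAbs m.natAbs) k) * Real.sqrt k * #k.divisors
      ≤ Real.sqrt (Int.gcd h k) * Real.sqrt k * #k.divisors := by gcongr
    _ = (#k.divisors : ℝ) * Real.sqrt k * Real.sqrt (Int.gcd h k) := by ring

/-- `(−h, k) = (h, k)`. [folklore] -/
theorem int_gcd_neg_natCast (h k : ℕ) : Int.gcd (-(h : ℤ)) k = Nat.gcd h k := by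
  rw [Int.neg_gcd, Int.gcd_natCast_natCast]

/-- **The `h`-sum of the gcd factors**: `∑_{1 ≤ h ≤ H₀} (h, k)^{1/2} ≤ τ(k) H₀` for `k ≥ 1`
(`(h,k)^{1/2} ≤ (h, k)` and `∑_{h ≤ H₀} (h, k) ≤ τ(k) H₀`). [folklore] -/
theorem sum_sqrt_gcd_le {k : ℕ} (hk : k ≠ 0) (H₀ : ℕ) :
    ∑ h ∈ Finset.Icc 1 H₀, Real.sqrt (Nat.gcd h k) ≤ (#k.divisors : ℝ) * H₀ := by
  have h1 : ∀ h ∈ Finset.Icc 1 H₀, Real.sqrt (Nat.gcd h k) ≤ (Nat.gcd h k : ℝ) := by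
    intro h _
    have hg1 : (1 : ℝ) ≤ Nat.gcd h k := by
      exact_mod_cast Nat.succ_le_of_lt (Nat.gcd_pos_of_pos_right _ (Nat.pos_of_ne_zero hk))
    rw [Real.sqrt_le_left (by linarith)]
    nlinarith
  exact (Finset.sum_le_sum h1).trans
    (LFunctions.MatomakiMerikoski.MatomakiMerikoski2023_lemma37_i hk H₀)

/-- `k⁻¹ √k = (√k)⁻¹` for `k > 0`. [folklore] -/
theorem inv_mul_sqrt {x : ℝ} (hx : 0 < x) : x⁻¹ * Real.sqrt x = (Real.sqrt x)⁻¹ := by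
  have hs : 0 < Real.sqrt x := Real.sqrt_pos.2 hx
  field_simp
  rw [Real.sq_sqrt hx.le]

/-! ### The off-diagonal part from Weil's bound -/

/-- **One term of `𝓚♯(H₀)`**: for `D > 0`, `k ≥ 1`, `(r, k) = 1`,
`‖k⁻¹ ∑_{1≤h≤H₀} (Φ_k(h) 𝓢_k(h) + Φ_k(−h) 𝓢_k(−h))‖ ≤ 2 D H₀ τ(k)² k^{-1/2}`
(`|Φ_k(±h)| ≤ D`, Weil, and `∑_{h ≤ H₀} (h,k)^{1/2} ≤ τ(k) H₀`). [folklore] -/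
theorem norm_offdiag_term_le {D : ℝ} (hD : 0 < D) {k r : ℕ} (hk : 0 < k) (hr : r.Coprime k)
    (n : ℤ) (H₀ : ℕ) :
    ‖((k : ℂ))⁻¹ * ∑ h ∈ Finset.Icc 1 H₀, (fcoef (D / 2) (D / 4) k h * kl k r n h +
        fcoef (D / 2) (D / 4) k (-(h : ℤ)) * kl k r n (-(h : ℤ)))‖ ≤
      2 * D * H₀ * ((#k.divisors : ℝ) ^ 2 * (Real.sqrt k)⁻¹) := by
  haveI : NeZero k := ⟨hk.ne'⟩
  have hY : (0 : ℝ) < D / 4 := by positivity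
  have hM : (0 : ℝ) ≤ D / 2 := by positivity
  have hΦ : ∀ h : ℤ, ‖fcoef (D / 2) (D / 4) k h‖ ≤ D := by
    intro h
    have := norm_fcoef_le hY hM k h
    linarith
  have hk0 : (0 : ℝ) < k := by exact_mod_cast hk
  set τ : ℝ := (#k.divisors : ℝ) with hτ
  have hτ0 : 0 ≤ τ := Nat.cast_nonneg _
  -- each `h`
  have hterm : ∀ h ∈ Finset.Icc 1 H₀,
      ‖fcoef (D / 2) (D / 4) k h * kl k r n h + fcoef (D / 2) (D / 4) k (-(h : ℤ)) * kl k r n (-(h : ℤ))‖ ≤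
        2 * D * (τ * Real.sqrt k) * Real.sqrt (Nat.gcd h k) := by
    intro h _
    have h1 := norm_kl_le_weil hr n (h : ℤ)
    have h2 := norm_kl_le_weil hr n (-(h : ℤ))
    rw [Int.gcd_natCast_natCast] at h1
    rw [int_gcd_neg_natCast] at h2
    have hkl0 : 0 ≤ τ * Real.sqrt k * Real.sqrt (Nat.gcd h k) := by positivity
    calc ‖fcoef (D / 2) (D / 4) k h * kl k r n h + fcoef (D / 2) (D / 4) k (-(h : ℤ)) * kl k r n (-(h : ℤ))‖
        ≤ ‖fcoef (D / 2) (D / 4) k h‖ * ‖kl k r n h‖ +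
            ‖fcoef (D / 2) (D / 4) k (-(h : ℤ))‖ * ‖kl k r n (-(h : ℤ))‖ := by
          refine (norm_add_le _ _).trans ?_
          rw [norm_mul, norm_mul]
      _ ≤ D * (τ * Real.sqrt k * Real.sqrt (Nat.gcd h k)) + D * (τ * Real.sqrt k * Real.sqrt (Nat.gcd h k)) :=
          add_le_add (mul_le_mul (hΦ _) h1 (norm_nonneg _) hD.le)
            (mul_le_mul (hΦ _) h2 (norm_nonneg _) hD.le)
      _ = 2 * D * (τ * Real.sqrt k) * Real.sqrt (Nat.gcd h k) := by ring
  rw [norm_mul, norm_inv, Complex.norm_natCast]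
  calc (k : ℝ)⁻¹ * ‖∑ h ∈ Finset.Icc 1 H₀, (fcoef (D / 2) (D / 4) k h * kl k r n h +
        fcoef (D / 2) (D / 4) k (-(h : ℤ)) * kl k r n (-(h : ℤ)))‖
      ≤ (k : ℝ)⁻¹ * ∑ h ∈ Finset.Icc 1 H₀, 2 * D * (τ * Real.sqrt k) * Real.sqrt (Nat.gcd h k) := by
        refine mul_le_mul_of_nonneg_left ((norm_sum_le _ _).trans (Finset.sum_le_sum hterm)) (by positivity)
    _ = 2 * D * τ * ((k : ℝ)⁻¹ * Real.sqrt k) * ∑ h ∈ Finset.Icc 1 H₀, Real.sqrt (Nat.gcd h k) := by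
        rw [← Finset.mul_sum]; ring
    _ ≤ 2 * D * τ * ((k : ℝ)⁻¹ * Real.sqrt k) * (τ * H₀) := by
        refine mul_le_mul_of_nonneg_left (sum_sqrt_gcd_le hk.ne' H₀) (by positivity)
    _ = 2 * D * H₀ * (τ ^ 2 * (Real.sqrt k)⁻¹) := by rw [inv_mul_sqrt hk0]; ring

/-- **`𝓚♯(H₀)` termwise from Weil's bound**: for `D > 0`, `S ≥ 0` and every `H₀`,
`‖𝓚♯(H₀)‖ ≤ 2 D H₀ ∑_{r,s,n} |B_{nrs}| ∑_{c ≤ 5C/4} w(c/C) τ(sc)² (sc)^{-1/2}`. [folklore] -/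
theorem norm_Koff_le_weil_sum {C D : ℝ} (hD : 0 < D) (N : ℕ) (R : ℝ) {S : ℝ} (hS : 0 ≤ S)
    (H₀ : ℕ) (B : ℕ → ℕ → ℕ → ℂ) :
    ‖Koff C D N R S H₀ B‖ ≤ 2 * D * H₀ *
      ∑ r ∈ dyadic R, ∑ s ∈ dyadic S, ∑ n ∈ Finset.Icc 1 N, ‖B n r s‖ *
        ∑ c ∈ Finset.Icc 1 ⌊5 / 4 * C⌋₊,
          plateau1 (c / C) * ((#(s * c).divisors : ℝ) ^ 2 * (Real.sqrt ((s * c : ℕ) : ℝ))⁻¹) := by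
  have hH : (0 : ℝ) ≤ 2 * D * H₀ := by positivity
  unfold Koff
  rw [Finset.mul_sum]
  refine (norm_sum_le _ _).trans (Finset.sum_le_sum fun r _ => ?_)
  rw [Finset.mul_sum]
  refine (norm_sum_le _ _).trans (Finset.sum_le_sum fun s hs' => ?_)
  have hs : 0 < s := pos_of_mem_dyadic hS hs'
  rw [Finset.mul_sum]
  refine (norm_sum_le _ _).trans (Finset.sum_le_sum fun n _ => ?_)
  rw [norm_mul, mul_left_comm]
  refine mul_le_mul_of_nonneg_left ?_ (norm_nonneg _)
  refine (norm_sum_le _ _).trans ?_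
  rw [Finset.mul_sum]
  -- termwise on the filtered set, then enlarge the set
  have hterm : ∀ c ∈ (Finset.Icc 1 ⌊5 / 4 * C⌋₊).filter (fun c => r.Coprime (s * c)),
      ‖((plateau1 (c / C) : ℝ) : ℂ) * (((s * c : ℕ) : ℂ)⁻¹ *
        ∑ h ∈ Finset.Icc 1 H₀, (fcoef (D / 2) (D / 4) (s * c) h * kl (s * c) r n h +
          fcoef (D / 2) (D / 4) (s * c) (-(h : ℤ)) * kl (s * c) r n (-(h : ℤ))))‖ ≤
      2 * D * H₀ * (plateau1 (c / C) * ((#(s * c).divisors : ℝ) ^ 2 * (Real.sqrt ((s * c : ℕ) : ℝ))⁻¹)) := by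
    intro c hc
    rw [Finset.mem_filter, Finset.mem_Icc] at hc
    have hk : 0 < s * c := Nat.mul_pos hs hc.1.1
    have hw0 : 0 ≤ plateau1 (c / C) := plateau_nonneg _
    have key := norm_offdiag_term_le hD hk hc.2 (n : ℤ) H₀
    rw [norm_mul, Complex.norm_real, Real.norm_eq_abs, abs_of_nonneg hw0]
    have e : (((s * c : ℕ) : ℂ)) = ((s * c : ℕ) : ℂ) := rfl
    calc plateau1 (c / C) * ‖((s * c : ℕ) : ℂ)⁻¹ *
          ∑ h ∈ Finset.Icc 1 H₀, (fcoef (D / 2) (D / 4) (s * c) h * kl (s * c) r n h +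
            fcoef (D / 2) (D / 4) (s * c) (-(h : ℤ)) * kl (s * c) r n (-(h : ℤ)))‖
        ≤ plateau1 (c / C) * (2 * D * H₀ * ((#(s * c).divisors : ℝ) ^ 2 * (Real.sqrt ((s * c : ℕ) : ℝ))⁻¹)) := by
          refine mul_le_mul_of_nonneg_left ?_ hw0
          simpa using key
      _ = _ := by ring
  refine (Finset.sum_le_sum hterm).trans ?_
  refine Finset.sum_le_sum_of_subset_of_nonneg (Finset.filter_subset _ _) fun c _ _ => ?_
  have hw0 : 0 ≤ plateau1 (c / C) := plateau_nonneg _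
  positivity

/-- `∑_{r,s,n} |B_{nrs}| ≤ 4 (RSN)^{1/2} ‖B‖` for `R, S ≥ 0`, `N' ≤ N` (Cauchy's inequality and
`♯{r ∼ R} ≤ 2R + 1 ≤ 4R` for `R ≥ 1/2`, etc.). [folklore] -/
theorem sum3_norm_le {R S N : ℝ} (hR : 1 / 2 ≤ R) (hS : 1 / 2 ≤ S) {N' : ℕ} (hN' : (N' : ℝ) ≤ N)
    (B : ℕ → ℕ → ℕ → ℂ) :
    ∑ r ∈ dyadic R, ∑ s ∈ dyadic S, ∑ n ∈ Finset.Icc 1 N', ‖B n r s‖ ≤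
      lemma1Norm N' R S B * (4 * Real.sqrt (R * S * N)) := by
  have hR0 : 0 ≤ R := by linarith
  have hS0 : 0 ≤ S := by linarith
  have hN0 : 0 ≤ N := le_trans (Nat.cast_nonneg _) hN'
  have hCS := sum3_mul_le_sqrt_mul_sqrt (dyadic R) (dyadic S) (Finset.Icc 1 N')
    (fun r s n => ‖B n r s‖) (fun _ _ _ => (1 : ℝ))
  have hcount : ∑ r ∈ dyadic R, ∑ s ∈ dyadic S, ∑ n ∈ Finset.Icc 1 N', (1 : ℝ) ^ 2 ≤ 16 * (R * S * N) := by
    simp only [one_pow, Finset.sum_const, nsmul_eq_mul, mul_one, Nat.card_Icc, Nat.add_sub_cancel]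
    have h1 := card_dyadic_le hR0
    have h2 := card_dyadic_le hS0
    calc (#(dyadic R) : ℝ) * ((#(dyadic S) : ℝ) * (N' : ℝ)) ≤ (4 * R) * ((4 * S) * N) := by
          apply mul_le_mul (by linarith) (mul_le_mul (by linarith) hN' (Nat.cast_nonneg _) (by linarith))
            (by positivity) (by linarith)
      _ = 16 * (R * S * N) := by ring
  have e : ∑ r ∈ dyadic R, ∑ s ∈ dyadic S, ∑ n ∈ Finset.Icc 1 N', ‖B n r s‖ =
      ∑ r ∈ dyadic R, ∑ s ∈ dyadic S, ∑ n ∈ Finset.Icc 1 N', ‖B n r s‖ * 1 := by simp only [mul_one]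
  rw [e]
  refine hCS.trans (mul_le_mul_of_nonneg_left ?_ (Real.sqrt_nonneg _))
  calc Real.sqrt (∑ r ∈ dyadic R, ∑ s ∈ dyadic S, ∑ n ∈ Finset.Icc 1 N', (1 : ℝ) ^ 2)
      ≤ Real.sqrt (16 * (R * S * N)) := Real.sqrt_le_sqrt hcount
    _ = 4 * Real.sqrt (R * S * N) := by
        rw [Real.sqrt_mul (by norm_num), show (16 : ℝ) = 4 ^ 2 by norm_num, Real.sqrt_sq (by norm_num)]

/-- **`𝓚♯(H₀)` from Weil's bound**: for every `η > 0` there is `K` such that for `C, D, N ≥ 1`,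
`R, S ≥ 1/2`, every `H₀` and all coefficients `B`,
`‖𝓚♯(H₀)‖ ≤ K (CDNRS)^η · D H₀ (CRN)^{1/2} ‖B‖`
(`w(c/C) = 0` unless `c > C/4`, so `(sc)^{-1/2} ≤ 2(SC)^{-1/2}`; `τ(sc) ≪ (CDNRS)^{η/4}`;
`∑_{r,s,n}|B| ≤ 4(RSN)^{1/2}‖B‖`). [folklore] -/
theorem norm_Koff_le_weil {η : ℝ} (hη : 0 < η) :
    ∃ K : ℝ, ∀ C D N R S : ℝ, 1 ≤ C → 1 ≤ D → 1 ≤ N → 1 / 2 ≤ R → 1 / 2 ≤ S →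
      ∀ (H₀ : ℕ) (B : ℕ → ℕ → ℕ → ℂ),
        ‖Koff C D ⌊N⌋₊ R S H₀ B‖ ≤
          K * (C * D * N * R * S) ^ η * (D * H₀ * Real.sqrt (C * R * N)) * lemma1Norm ⌊N⌋₊ R S B := by
  -- divisor bound at exponent `δ = η/4`
  set δ : ℝ := η / 4 with hδ
  have hδ0 : 0 < δ := by positivity
  obtain ⟨Cδ, hCδ1, hτ⟩ := exists_card_divisors_le_mul_rpow' hδ0
  have hCδ0 : 0 ≤ Cδ := by linarith
  refine ⟨40 * Cδ ^ 2 * 40 ^ (2 * δ), ?_⟩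
  intro C D N R S hC hD hN hR hS H₀ B
  have hD0 : 0 < D := by linarith
  have hS0 : 0 < S := by linarith
  have hR0 : 0 < R := by linarith
  have hC0 : 0 < C := by linarith
  set N' : ℕ := ⌊N⌋₊ with hN'
  have hN'le : (N' : ℝ) ≤ N := Nat.floor_le (by linarith)
  set X : ℕ := ⌊5 / 4 * C⌋₊ with hX
  set P : ℝ := C * D * N * R * S with hP
  have hP0 : 0 < P := by positivity
  -- sizes
  have hCD : 1 ≤ C * D := one_le_mul_of_one_le_of_one_le hC hD
  have hRS : 1 / 4 ≤ R * S := by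
    have := mul_le_mul hR hS (by norm_num) hR0.le
    linarith
  have hCP : C ≤ 4 * P := by
    have h1 : 1 * (1 / 4) ≤ D * N * (R * S) :=
      mul_le_mul (one_le_mul_of_one_le_of_one_le hD hN) hRS (by norm_num) (by positivity)
    have h2 : C * (1 * (1 / 4)) ≤ C * (D * N * (R * S)) := mul_le_mul_of_nonneg_left h1 (by linarith)
    have h3 : P = C * (D * N * (R * S)) := by rw [hP]; ring
    rw [h3]; linarith
  have hSP : S ≤ 4 * P := by
    have h1 : 1 * (1 / 2) ≤ C * D * N * R :=
      mul_le_mul (one_le_mul_of_one_le_of_one_le hCD hN) hR (by norm_num) (by positivity)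
    have h2 : S * (1 * (1 / 2)) ≤ S * (C * D * N * R) := mul_le_mul_of_nonneg_left h1 hS0.le
    have h3 : P = S * (C * D * N * R) := by rw [hP]; ring
    have h4 : 0 ≤ S * (C * D * N * R) := by positivity
    rw [h3]; linarith
  -- the uniform divisor bound `τ(sc) ≤ T` for `s ≤ 2S`, `c ≤ 5C/4`
  set T : ℝ := Cδ * (40 * P ^ 2) ^ δ with hT
  have hT0 : 0 ≤ T := by positivity
  have hτsc : ∀ s ∈ dyadic S, ∀ c ∈ Finset.Icc 1 X, (#(s * c).divisors : ℝ) ≤ T := by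
    intro s hs c hc
    have hsm := (mem_dyadic hS0.le).1 hs
    have hcle : (c : ℝ) ≤ 5 / 4 * C := le_trans (by exact_mod_cast (Finset.mem_Icc.1 hc).2) (Nat.floor_le (by linarith))
    have hsc : ((s * c : ℕ) : ℝ) ≤ 40 * P ^ 2 := by
      push_cast
      calc (s : ℝ) * c ≤ (2 * S) * (5 / 4 * C) := mul_le_mul hsm.2 hcle (by positivity) (by positivity)
        _ ≤ (2 * (4 * P)) * (5 / 4 * (4 * P)) := by gcongr
        _ = 40 * P ^ 2 := by ring
    calc (#(s * c).divisors : ℝ) ≤ Cδ * ((s * c : ℕ) : ℝ) ^ δ := hτ (s * c)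
      _ ≤ Cδ * (40 * P ^ 2) ^ δ :=
          mul_le_mul_of_nonneg_left (Real.rpow_le_rpow (Nat.cast_nonneg _) hsc hδ0.le) hCδ0
  -- the inner `c`-sum: `≤ (5C/4) · T² · 2 (SC)^{-1/2}`
  have hinner : ∀ s ∈ dyadic S, ∑ c ∈ Finset.Icc 1 X,
      plateau1 (c / C) * ((#(s * c).divisors : ℝ) ^ 2 * (Real.sqrt ((s * c : ℕ) : ℝ))⁻¹) ≤
        5 / 2 * T ^ 2 * (Real.sqrt C * (Real.sqrt S)⁻¹) := by
    intro s hs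
    have hsm := (mem_dyadic hS0.le).1 hs
    have hterm : ∀ c ∈ Finset.Icc 1 X,
        plateau1 (c / C) * ((#(s * c).divisors : ℝ) ^ 2 * (Real.sqrt ((s * c : ℕ) : ℝ))⁻¹) ≤
          T ^ 2 * (2 * (Real.sqrt (S * C))⁻¹) := by
      intro c hc
      have hw0 : 0 ≤ plateau1 (c / C) := plateau_nonneg _
      have hw1 : plateau1 (c / C) ≤ 1 := plateau_le_one _
      rcases le_or_gt ((c : ℝ) / C) (1 / 4) with hsmall | hbig
      · rw [plateau_eq_zero_of_le hsmall, zero_mul]; positivity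
      · -- `c > C/4`, so `sc > SC/4`
        have hcC : C / 4 < c := by
          rw [lt_div_iff₀ hC0] at hbig; linarith
        have hscl : S * C / 4 ≤ ((s * c : ℕ) : ℝ) := by
          push_cast
          have := mul_le_mul hsm.1.le hcC.le (by positivity) (Nat.cast_nonneg _)
          linarith
        have hSC0 : 0 < S * C := by positivity
        have hsqrt : Real.sqrt (S * C) / 2 ≤ Real.sqrt ((s * c : ℕ) : ℝ) := by
          rw [show Real.sqrt (S * C) / 2 = Real.sqrt (S * C / 4) by
            rw [Real.sqrt_div' _ (by norm_num : (0 : ℝ) ≤ 4), show Real.sqrt (4 : ℝ) = 2 by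
              rw [show (4 : ℝ) = 2 ^ 2 by norm_num, Real.sqrt_sq (by norm_num)]]]
          exact Real.sqrt_le_sqrt hscl
        have hinv : (Real.sqrt ((s * c : ℕ) : ℝ))⁻¹ ≤ 2 * (Real.sqrt (S * C))⁻¹ := by
          rw [show 2 * (Real.sqrt (S * C))⁻¹ = (Real.sqrt (S * C) / 2)⁻¹ by
            rw [inv_div]; ring]
          exact inv_anti₀ (by positivity) hsqrt
        have hτ2 : (#(s * c).divisors : ℝ) ^ 2 ≤ T ^ 2 :=
          pow_le_pow_left₀ (Nat.cast_nonneg _) (hτsc s hs c hc) 2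
        calc plateau1 (c / C) * ((#(s * c).divisors : ℝ) ^ 2 * (Real.sqrt ((s * c : ℕ) : ℝ))⁻¹)
            ≤ 1 * (T ^ 2 * (2 * (Real.sqrt (S * C))⁻¹)) :=
              mul_le_mul hw1 (mul_le_mul hτ2 hinv (by positivity) (by positivity)) (by positivity) zero_le_one
          _ = _ := one_mul _
    refine (Finset.sum_le_sum hterm).trans ?_
    rw [Finset.sum_const, Nat.card_Icc, Nat.add_sub_cancel, nsmul_eq_mul]
    have hXle : ((X : ℕ) : ℝ) ≤ 5 / 4 * C := Nat.floor_le (by linarith)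
    have hsqrtSC : (Real.sqrt (S * C))⁻¹ = (Real.sqrt S)⁻¹ * (Real.sqrt C)⁻¹ := by
      rw [Real.sqrt_mul hS0.le, mul_inv]
    have hCsq : C = Real.sqrt C * Real.sqrt C := (Real.mul_self_sqrt hC0.le).symm
    calc ((X : ℕ) : ℝ) * (T ^ 2 * (2 * (Real.sqrt (S * C))⁻¹))
        ≤ (5 / 4 * C) * (T ^ 2 * (2 * (Real.sqrt (S * C))⁻¹)) :=
          mul_le_mul_of_nonneg_right hXle (by positivity)
      _ = 5 / 2 * T ^ 2 * (C * (Real.sqrt (S * C))⁻¹) := by ring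
      _ = 5 / 2 * T ^ 2 * (Real.sqrt C * (Real.sqrt S)⁻¹) := by
          congr 1
          rw [hsqrtSC]
          have hsC : 0 < Real.sqrt C := Real.sqrt_pos.2 hC0
          field_simp
          nth_rewrite 1 [hCsq]
          ring
  -- Step: termwise bound and the triple sum
  have h1 := norm_Koff_le_weil_sum (C := C) hD0 N' R hS0.le H₀ B
  have h2 : ∑ r ∈ dyadic R, ∑ s ∈ dyadic S, ∑ n ∈ Finset.Icc 1 N', ‖B n r s‖ *
      ∑ c ∈ Finset.Icc 1 X, plateau1 (c / C) * ((#(s * c).divisors : ℝ) ^ 2 * (Real.sqrt ((s * c : ℕ) : ℝ))⁻¹) ≤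
      (5 / 2 * T ^ 2 * (Real.sqrt C * (Real.sqrt S)⁻¹)) *
        ∑ r ∈ dyadic R, ∑ s ∈ dyadic S, ∑ n ∈ Finset.Icc 1 N', ‖B n r s‖ := by
    rw [Finset.mul_sum]
    refine Finset.sum_le_sum fun r _ => ?_
    rw [Finset.mul_sum]
    refine Finset.sum_le_sum fun s hs => ?_
    rw [Finset.mul_sum]
    refine Finset.sum_le_sum fun n _ => ?_
    rw [mul_comm (5 / 2 * T ^ 2 * (Real.sqrt C * (Real.sqrt S)⁻¹))]
    exact mul_le_mul_of_nonneg_left (hinner s hs) (norm_nonneg _)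
  have h3 := sum3_norm_le hR hS hN'le B
  -- powers of `P`
  have hTsq : T ^ 2 = Cδ ^ 2 * 40 ^ (2 * δ) * P ^ η := by
    rw [hT, mul_pow]
    have e1 : ((40 * P ^ 2) ^ δ) ^ 2 = (40 : ℝ) ^ (2 * δ) * P ^ η := by
      rw [← Real.rpow_natCast, ← Real.rpow_mul (by positivity), Real.mul_rpow (by norm_num) (by positivity),
        show (P ^ 2 : ℝ) = P ^ (2 : ℝ) by norm_cast, ← Real.rpow_mul hP0.le]
      congr 1
      · congr 1; push_cast; ring
      · congr 1; rw [hδ]; push_cast; ring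
    rw [e1]; ring
  -- `√C/√S · √(RSN) = √(CRN)`
  have hsqrts : Real.sqrt C * (Real.sqrt S)⁻¹ * Real.sqrt (R * S * N) = Real.sqrt (C * R * N) := by
    have hsS : 0 < Real.sqrt S := Real.sqrt_pos.2 hS0
    rw [show R * S * N = S * (R * N) by ring, Real.sqrt_mul hS0.le, show C * R * N = C * (R * N) by ring,
      Real.sqrt_mul hC0.le]
    field_simp
  have hnorm0 : 0 ≤ lemma1Norm N' R S B := Real.sqrt_nonneg _
  calc ‖Koff C D N' R S H₀ B‖
      ≤ 2 * D * H₀ * ((5 / 2 * T ^ 2 * (Real.sqrt C * (Real.sqrt S)⁻¹)) *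
          ∑ r ∈ dyadic R, ∑ s ∈ dyadic S, ∑ n ∈ Finset.Icc 1 N', ‖B n r s‖) :=
        h1.trans (mul_le_mul_of_nonneg_left h2 (by positivity))
    _ ≤ 2 * D * H₀ * ((5 / 2 * T ^ 2 * (Real.sqrt C * (Real.sqrt S)⁻¹)) *
          (lemma1Norm N' R S B * (4 * Real.sqrt (R * S * N)))) := by
        refine mul_le_mul_of_nonneg_left (mul_le_mul_of_nonneg_left h3 (by positivity)) (by positivity)
    _ = 20 * T ^ 2 * (D * H₀ * (Real.sqrt C * (Real.sqrt S)⁻¹ * Real.sqrt (R * S * N))) * lemma1Norm N' R S B := by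
        ring
    _ = 20 * (Cδ ^ 2 * 40 ^ (2 * δ) * P ^ η) * (D * H₀ * Real.sqrt (C * R * N)) * lemma1Norm N' R S B := by
        rw [hsqrts, hTsq]
    _ = 40 * Cδ ^ 2 * 40 ^ (2 * δ) * P ^ η * (D * H₀ * Real.sqrt (C * R * N)) * lemma1Norm N' R S B / 2 := by
        ring
    _ ≤ 40 * Cδ ^ 2 * 40 ^ (2 * δ) * P ^ η * (D * H₀ * Real.sqrt (C * R * N)) * lemma1Norm N' R S B := by
        have : 0 ≤ 40 * Cδ ^ 2 * 40 ^ (2 * δ) * P ^ η * (D * H₀ * Real.sqrt (C * R * N)) * lemma1Norm N' R S B := by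
          positivity
        linarith

/-! ### The unconditional bound for `𝓚` -/

/-- **The unconditional (Weil) bound for BFI's sums of Kloosterman fractions**, weight `w ⊗ w`:
for every `ε > 0` there is `K` such that for all `C, D, N ≥ 1`, `R, S ≥ 1/2` and all `B`,
`‖𝓚(C, D, N, R, S)‖ ≤ K (CDNRS)^ε C^{1/2} (CS + D) (RN)^{1/2} ‖B‖`.
Proof: `𝓚 = 𝓚₀ + 𝓚♯(H₀) + O_ε(‖B‖)` with `H₀ = ⌈2(CDNRS)^{ε/2}SC/D⌉`
(`BFI.L1.norm_dispK_sub_Kzero_sub_Koff_le`, `BFI.L1.tail_total_le`), `‖𝓚₀‖ ≪ (CDNRS)^ε D(NR)^{1/2}‖B‖`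
(`BFI.L1.norm_Kzero_le`) and `‖𝓚♯(H₀)‖ ≪ (CDNRS)^{ε/2} D H₀ (CRN)^{1/2}‖B‖` (`norm_Koff_le_weil`),
`D H₀ ≤ 2(CDNRS)^{ε/2} SC + D`.  (Deshouillers–Iwaniec's Theorem 12 — Kuznetsov's formula and the
spectral large sieve — improves `C^{1/2}(CS + D)(RN)^{1/2}` to
`{CS(RS+N)(C+DR) + C²DS√((RS+N)R) + D²NR}^{1/2}`.) [folklore] -/
theorem norm_dispK_le_weil {ε : ℝ} (hε : 0 < ε) :
    ∃ K : ℝ, ∀ C D N R S : ℝ, 1 ≤ C → 1 ≤ D → 1 ≤ N → 1 / 2 ≤ R → 1 / 2 ≤ S →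
      ∀ B : ℕ → ℕ → ℕ → ℂ,
        ‖dispK (fun c d => plateau2 (c / C) (d / D)) ⌊5 / 4 * C⌋₊ ⌊5 / 4 * D⌋₊ ⌊N⌋₊ R S B‖ ≤
          K * (C * D * N * R * S) ^ ε * (Real.sqrt C * (C * S + D) * Real.sqrt (R * N)) *
            lemma1Norm ⌊N⌋₊ R S B := by
  have hε2 : 0 < ε / 2 := by positivity
  obtain ⟨K₁, hK₁⟩ := norm_Koff_le_weil hε2
  obtain ⟨K₀, hK₀⟩ := norm_Kzero_le hε
  obtain ⟨Kt, hKt⟩ := tail_total_le hε2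
  refine ⟨max K₀ 0 + 2 * 4 ^ (ε / 2) * max K₁ 0 + 2 * 4 ^ ε * max Kt 0, ?_⟩
  intro C D N R S hC hD hN hR hS B
  have hD0 : 0 < D := by linarith
  have hS0 : 0 ≤ S := by linarith
  have hS0' : 0 < S := by linarith
  have hR0 : 0 ≤ R := by linarith
  have hC0 : 0 < C := by linarith
  set P : ℝ := C * D * N * R * S with hP
  have hP0 : 0 < P := by positivity
  set H₀ : ℕ := ⌈2 * P ^ (ε / 2) * S * C / D⌉₊ with hH₀
  set j : ℕ := ⌈6 / (ε / 2)⌉₊ + 2 with hj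
  have hj2 : 2 ≤ j := by omega
  set N' : ℕ := ⌊N⌋₊ with hN'
  set G : ℝ := Real.sqrt C * (C * S + D) * Real.sqrt (R * N) with hG
  have hnB : 0 ≤ lemma1Norm N' R S B := Real.sqrt_nonneg _
  have hPε : 0 ≤ P ^ ε := Real.rpow_nonneg hP0.le _
  have hPε2 : 0 ≤ P ^ (ε / 2) := Real.rpow_nonneg hP0.le _
  have hsC1 : 1 ≤ Real.sqrt C := by
    rw [show (1 : ℝ) = Real.sqrt 1 by rw [Real.sqrt_one]]
    exact Real.sqrt_le_sqrt hC
  have hCSD1 : 1 ≤ C * S + D := by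
    have : 0 ≤ C * S := by positivity
    linarith
  have hCSD0 : 0 ≤ C * S + D := by positivity
  have hG0 : 0 ≤ G := by positivity
  -- the three pieces
  have h0 := hK₀ C D N R S hC hD hN hR hS B
  have h1 := hK₁ C D N R S hC hD hN hR hS H₀ B
  have h2 := (norm_dispK_sub_Kzero_sub_Koff_le (C := C) hD0 N' R hS0 H₀ hj2 B).trans
    (hKt C D N R S hC hD hN hR hS B)
  -- (i) `D √(NR) ≤ G`
  have hI1 : D * Real.sqrt (N * R) ≤ G := by
    rw [hG, show N * R = R * N by ring]
    have hRN0 : 0 ≤ Real.sqrt (R * N) := Real.sqrt_nonneg _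
    have hDle : D ≤ C * S + D := by
      have : 0 ≤ C * S := by positivity
      linarith
    calc D * Real.sqrt (R * N) = 1 * D * Real.sqrt (R * N) := by ring
      _ ≤ Real.sqrt C * (C * S + D) * Real.sqrt (R * N) := by
          refine mul_le_mul_of_nonneg_right (mul_le_mul hsC1 hDle hD0.le (by positivity)) hRN0
  -- (ii) `D H₀ √(CRN) ≤ 2 · 4^{ε/2} P^{ε/2} G`
  have h4P1 : 1 ≤ 4 * P := by
    have hCD : 1 ≤ C * D := one_le_mul_of_one_le_of_one_le hC hD
    have hRS : 1 / 4 ≤ R * S := by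
      have := mul_le_mul hR hS (by norm_num) hR0
      linarith
    have h1' : 1 * (1 / 4) ≤ (C * D * N) * (R * S) :=
      mul_le_mul (one_le_mul_of_one_le_of_one_le hCD hN) hRS (by norm_num) (by positivity)
    have h3 : P = (C * D * N) * (R * S) := by rw [hP]; ring
    rw [h3]; linarith
  have h4P : 1 ≤ (4 : ℝ) ^ (ε / 2) * P ^ (ε / 2) := by
    rw [← Real.mul_rpow (by norm_num) hP0.le]
    exact Real.one_le_rpow h4P1 hε2.le
  have h4P' : 1 ≤ (4 : ℝ) ^ ε * P ^ ε := by
    rw [← Real.mul_rpow (by norm_num) hP0.le]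
    exact Real.one_le_rpow h4P1 hε.le
  have hI2 : D * H₀ * Real.sqrt (C * R * N) ≤ 2 * 4 ^ (ε / 2) * P ^ (ε / 2) * G := by
    have hH : (H₀ : ℝ) ≤ 2 * P ^ (ε / 2) * S * C / D + 1 := by
      have := Nat.ceil_lt_add_one (by positivity : 0 ≤ 2 * P ^ (ε / 2) * S * C / D)
      exact this.le
    have hDH : D * H₀ ≤ 2 * P ^ (ε / 2) * (C * S) + D := by
      calc D * (H₀ : ℝ) ≤ D * (2 * P ^ (ε / 2) * S * C / D + 1) := mul_le_mul_of_nonneg_left hH hD0.le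
        _ = 2 * P ^ (ε / 2) * (C * S) + D := by field_simp
    have hDH' : 2 * P ^ (ε / 2) * (C * S) + D ≤ 2 * (4 ^ (ε / 2) * P ^ (ε / 2)) * (C * S + D) := by
      have h41 : (1 : ℝ) ≤ 4 ^ (ε / 2) := Real.one_le_rpow (by norm_num) hε2.le
      have hCS0 : 0 ≤ C * S := by positivity
      have hP4 : P ^ (ε / 2) ≤ 4 ^ (ε / 2) * P ^ (ε / 2) := le_mul_of_one_le_left hPε2 h41
      have ha : 2 * P ^ (ε / 2) * (C * S) ≤ 2 * (4 ^ (ε / 2) * P ^ (ε / 2)) * (C * S) :=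
        mul_le_mul_of_nonneg_right (mul_le_mul_of_nonneg_left hP4 (by norm_num)) hCS0
      have hb : D ≤ 2 * (4 ^ (ε / 2) * P ^ (ε / 2)) * D := by
        have h2 : (1 : ℝ) ≤ 2 * (4 ^ (ε / 2) * P ^ (ε / 2)) := by linarith [h4P]
        calc D = 1 * D := (one_mul D).symm
          _ ≤ 2 * (4 ^ (ε / 2) * P ^ (ε / 2)) * D := mul_le_mul_of_nonneg_right h2 hD0.le
      calc 2 * P ^ (ε / 2) * (C * S) + D
          ≤ 2 * (4 ^ (ε / 2) * P ^ (ε / 2)) * (C * S) + 2 * (4 ^ (ε / 2) * P ^ (ε / 2)) * D :=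
            add_le_add ha hb
        _ = 2 * (4 ^ (ε / 2) * P ^ (ε / 2)) * (C * S + D) := by ring
    have hsq : Real.sqrt (C * R * N) = Real.sqrt C * Real.sqrt (R * N) := by
      rw [show C * R * N = C * (R * N) by ring, Real.sqrt_mul hC0.le]
    have hRN0 : 0 ≤ Real.sqrt (R * N) := Real.sqrt_nonneg _
    calc D * H₀ * Real.sqrt (C * R * N) = (D * H₀) * (Real.sqrt C * Real.sqrt (R * N)) := by rw [hsq]
      _ ≤ (2 * (4 ^ (ε / 2) * P ^ (ε / 2)) * (C * S + D)) * (Real.sqrt C * Real.sqrt (R * N)) :=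
          mul_le_mul_of_nonneg_right (hDH.trans hDH') (by positivity)
      _ = 2 * 4 ^ (ε / 2) * P ^ (ε / 2) * G := by rw [hG]; ring
  -- (iii) `1 ≤ 2 · 4^ε P^ε G`
  have hI3 : 1 ≤ 2 * 4 ^ ε * (P ^ ε * G) := by
    have hG_ge : 1 / 2 ≤ G := by
      rw [hG]
      have hRN : 1 / 2 ≤ Real.sqrt (R * N) := by
        have h14 : (1 / 4 : ℝ) ≤ R * N := by
          have := mul_le_mul hR hN (by norm_num) hR0
          linarith
        calc (1 / 2 : ℝ) = Real.sqrt ((1 / 2) ^ 2) := by rw [Real.sqrt_sq (by norm_num)]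
          _ ≤ Real.sqrt (R * N) := Real.sqrt_le_sqrt (by linarith)
      have h11 : (1 : ℝ) ≤ Real.sqrt C * (C * S + D) := one_le_mul_of_one_le_of_one_le hsC1 hCSD1
      calc (1 / 2 : ℝ) = 1 * (1 / 2) := by ring
        _ ≤ Real.sqrt C * (C * S + D) * Real.sqrt (R * N) :=
            mul_le_mul h11 hRN (by norm_num) (by positivity)
    calc (1 : ℝ) = 2 * 1 * (1 / 2) := by ring
      _ ≤ 2 * (4 ^ ε * P ^ ε) * G :=
          mul_le_mul (mul_le_mul_of_nonneg_left h4P' (by norm_num)) hG_ge (by norm_num) (by positivity)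
      _ = 2 * 4 ^ ε * (P ^ ε * G) := by ring
  -- triangle inequality
  have htri : ‖dispK (fun c d => plateau2 (c / C) (d / D)) ⌊5 / 4 * C⌋₊ ⌊5 / 4 * D⌋₊ N' R S B‖ ≤
      ‖Kzero C D N' R S B‖ + ‖Koff C D N' R S H₀ B‖ +
        ‖dispK (fun c d => plateau2 (c / C) (d / D)) ⌊5 / 4 * C⌋₊ ⌊5 / 4 * D⌋₊ N' R S B -
          Kzero C D N' R S B - Koff C D N' R S H₀ B‖ := by
    set x := dispK (fun c d => plateau2 (c / C) (d / D)) ⌊5 / 4 * C⌋₊ ⌊5 / 4 * D⌋₊ N' R S B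
    set y := Kzero C D N' R S B
    set z := Koff C D N' R S H₀ B
    calc ‖x‖ = ‖y + z + (x - y - z)‖ := by congr 1; ring
      _ ≤ ‖y + z‖ + ‖x - y - z‖ := norm_add_le _ _
      _ ≤ ‖y‖ + ‖z‖ + ‖x - y - z‖ := by linarith [norm_add_le y z]
  -- each piece against `P^ε G ‖B‖`
  have hA : ‖Kzero C D N' R S B‖ ≤ max K₀ 0 * (P ^ ε * G * lemma1Norm N' R S B) := by
    refine h0.trans ?_
    calc K₀ * P ^ ε * (D * Real.sqrt (N * R)) * lemma1Norm N' R S B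
        = K₀ * (P ^ ε * (D * Real.sqrt (N * R)) * lemma1Norm N' R S B) := by ring
      _ ≤ max K₀ 0 * (P ^ ε * (D * Real.sqrt (N * R)) * lemma1Norm N' R S B) :=
          mul_le_mul_of_nonneg_right (le_max_left _ _) (by positivity)
      _ ≤ max K₀ 0 * (P ^ ε * G * lemma1Norm N' R S B) := by
          refine mul_le_mul_of_nonneg_left ?_ (le_max_right _ _)
          exact mul_le_mul_of_nonneg_right (mul_le_mul_of_nonneg_left hI1 hPε) hnB
  have hPP : P ^ (ε / 2) * P ^ (ε / 2) = P ^ ε := by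
    rw [← Real.rpow_add hP0]; congr 1; ring
  have hBoff : ‖Koff C D N' R S H₀ B‖ ≤ 2 * 4 ^ (ε / 2) * max K₁ 0 * (P ^ ε * G * lemma1Norm N' R S B) := by
    refine h1.trans ?_
    calc K₁ * P ^ (ε / 2) * (D * H₀ * Real.sqrt (C * R * N)) * lemma1Norm N' R S B
        = K₁ * (P ^ (ε / 2) * (D * H₀ * Real.sqrt (C * R * N)) * lemma1Norm N' R S B) := by ring
      _ ≤ max K₁ 0 * (P ^ (ε / 2) * (D * H₀ * Real.sqrt (C * R * N)) * lemma1Norm N' R S B) :=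
          mul_le_mul_of_nonneg_right (le_max_left _ _) (by positivity)
      _ ≤ max K₁ 0 * (P ^ (ε / 2) * (2 * 4 ^ (ε / 2) * P ^ (ε / 2) * G) * lemma1Norm N' R S B) := by
          refine mul_le_mul_of_nonneg_left ?_ (le_max_right _ _)
          exact mul_le_mul_of_nonneg_right (mul_le_mul_of_nonneg_left hI2 hPε2) hnB
      _ = 2 * 4 ^ (ε / 2) * max K₁ 0 * ((P ^ (ε / 2) * P ^ (ε / 2)) * G * lemma1Norm N' R S B) := by ring
      _ = 2 * 4 ^ (ε / 2) * max K₁ 0 * (P ^ ε * G * lemma1Norm N' R S B) := by rw [hPP]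
  have hCtail : ‖dispK (fun c d => plateau2 (c / C) (d / D)) ⌊5 / 4 * C⌋₊ ⌊5 / 4 * D⌋₊ N' R S B -
      Kzero C D N' R S B - Koff C D N' R S H₀ B‖ ≤
      2 * 4 ^ ε * max Kt 0 * (P ^ ε * G * lemma1Norm N' R S B) := by
    refine h2.trans ?_
    calc Kt * lemma1Norm N' R S B ≤ max Kt 0 * lemma1Norm N' R S B :=
          mul_le_mul_of_nonneg_right (le_max_left _ _) hnB
      _ = max Kt 0 * lemma1Norm N' R S B * 1 := (mul_one _).symm
      _ ≤ max Kt 0 * lemma1Norm N' R S B * (2 * 4 ^ ε * (P ^ ε * G)) :=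
          mul_le_mul_of_nonneg_left hI3 (by positivity)
      _ = 2 * 4 ^ ε * max Kt 0 * (P ^ ε * G * lemma1Norm N' R S B) := by ring
  calc ‖dispK (fun c d => plateau2 (c / C) (d / D)) ⌊5 / 4 * C⌋₊ ⌊5 / 4 * D⌋₊ N' R S B‖
      ≤ max K₀ 0 * (P ^ ε * G * lemma1Norm N' R S B) +
          2 * 4 ^ (ε / 2) * max K₁ 0 * (P ^ ε * G * lemma1Norm N' R S B) +
          2 * 4 ^ ε * max Kt 0 * (P ^ ε * G * lemma1Norm N' R S B) := by
        linarith [htri, hA, hBoff, hCtail]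
    _ = (max K₀ 0 + 2 * 4 ^ (ε / 2) * max K₁ 0 + 2 * 4 ^ ε * max Kt 0) * P ^ ε * G *
          lemma1Norm N' R S B := by ring

end L1

end BFI

end Literature.NumberTheory.Sieve
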